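import Summits.BirchSwinnertonDyer.Rank1Residual.Additive.KatoDescentKatoRigidGroupLike
import HarnessLib

set_option autoImplicit false

/-!
# AUG engine, step 9: the CHARACTER DICTIONARY — a value `χ̄(χ_cyc σ)` of a character of `Γ_n` is the evaluation at
# `u = 1 ⊗ χ̄(χ_cyc γ)` of the group-like Iwasawa element `[σ] = (1 + T)^{κ(σ)}`
# (seat `bsd-cm-prr-ty1` g14, cell `bsd-cm`; theorems only: no definition, no named fact, no instance, no `sorry`)

Part 51 of the seat's kernel cut of stub 3 (cruxes stmt-BirchSwinnertonDyer-19945 / -19223).  In (★χ) (E33/E35) the explicit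
cyclotomic numbers are built from `χ̄(c)`, `χ̄(d)`, `χ̄(cd)` (cusp factors), `χ(ℓ)` (removed Euler factors) and `χ̄(a)` (frame
twist), i.e. from values `χ^{±1}(χ_cyc σ)` at Galois elements `σ` (`σ_c`, `Frob_ℓ`, …); the successor's ENDGAME (HOME
`bsd-cm-prr-ty1/STUB3-CUT.md` §6 addendum 7 (a)) reads them as values of Iwasawa functions.  THIS FILE is the dictionary: for the
cyclotomic `ℤ_p`-extension character `κ : Gal(ℚ̄/ℚ) → ℤ_p` with topological generator `γ` (`κ γ = 1`), a character `χ` mod `m`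
killing `χ_cyc(Gal(ℚ̄/ℚ_n))`, `σ ∈ Gal(ℚ̄/ℚ)` and `a ∈ ℕ` with `κ(σ) ≡ a (mod p^n)`:
* `pow_inv_mul_mem_layerSubgroup` — `γ^{−a}σ ∈ Gal(ℚ̄/ℚ_n)`;
* `apply_cyc_eq_pow` — `χ(χ_cyc σ) = χ(χ_cyc γ)^a`, `inv_apply_cyc_eq_pow` — `χ̄(χ_cyc σ) = χ̄(χ_cyc γ)^a`;
* ★ `one_tmul_inv_apply_cyc_eq_aeval` — **`1 ⊗ χ̄(χ_cyc σ) = r(u − 1)`** in `ℚ_p ⊗_ℚ ℂ` for `u = 1 ⊗ χ̄(χ_cyc γ)` and ANY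
  polynomial representative `r ≡ (1 + T)^{κ(σ)} (mod ω_n)` (E37 `aeval_eq_pow_of_binomialSeries`, E34
  `one_tmul_inv_apply_pow_eq_one`): the value of `χ̄` at `σ` IS the value at `u` of the group-like element `[σ] ∈ Λ`.
So every ingredient of (★χ) is `Φ(u − 1)` for an EXPLICIT `Φ ∈ ℚ·Λ` independent of `χ` and `n` (cusp factor:
`c²d²s₁·1 − cd²s₂·[σ_c] − c²ds₃·[σ_d] + cds₄·[σ_{cd}]`; Euler factor at `ℓ`: `1 − (a_ℓ/ℓ)[Frob_ℓ]^{-1}… `, frame twist `[σ_α]`),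
which is what the separation step (c) consumes.
HONEST LABEL: Iwasawa-algebra plumbing; AUG displayed; no stub closed; nothing asserted on 19945 / 19223; BSD is not proved for any curve.
References: [Washington1997] §7.1–§7.2, §13.1; [Kato2004Asterisque] §13.8 (p. 228), Thm. 6.6 (1) (p. 163).
-/

noncomputable section

open scoped TensorProduct
open Polynomial Field
open Literature.NumberTheory.GaloisRepresentations
open Literature.NumberTheory.EllipticCurves Literature.NumberTheory.EllipticCurves.Kato2004

namespace Summit.BirchSwinnertonDyer.Rank1Residual.Additive.PerrinRiouUnit

variable {p : ℕ} [Fact p.Prime] {K : ZpExtension ℚ p} {γ : absoluteGaloisGroup ℚ} {m : ℕ} [NeZero m]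

/-- `γ^{−a}·σ ∈ Gal(ℚ̄/ℚ_n)` when `κ(σ) ≡ a (mod p^n)` and `κ(γ) = 1`. [cite: Washington1997, §13.1] -/
theorem pow_inv_mul_mem_layerSubgroup (hγ : K.IsTopGenerator γ) {σ : absoluteGaloisGroup ℚ} {a n : ℕ}
    (ha : ((p : ℤ_[p]) ^ n) ∣ (K σ).toAdd - a) : (γ ^ a)⁻¹ * σ ∈ K.layerSubgroup n := by
  have hγ' : K γ = Multiplicative.ofAdd 1 := hγ
  rw [ZpExtension.mem_layerSubgroup, map_mul, map_inv, map_pow, hγ', ← ofAdd_nsmul, toAdd_mul, toAdd_inv, toAdd_ofAdd,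
    nsmul_eq_mul, mul_one]
  rwa [sub_eq_neg_add] at ha

/-- **`χ(χ_cyc σ) = χ(χ_cyc γ)^a`** for `κ(σ) ≡ a (mod p^n)` and `χ` killing `χ_cyc(Gal(ℚ̄/ℚ_n))`. [cite: Washington1997, §13.1] -/
theorem apply_cyc_eq_pow (hγ : K.IsTopGenerator γ) {n : ℕ} (χ : DirichletCharacter ℂ m)
    (hχ : ∀ τ ∈ K.layerSubgroup n, χ ((modNCyclotomicCharacter ℚ m τ : (ZMod m)ˣ) : ZMod m) = 1)
    {σ : absoluteGaloisGroup ℚ} {a : ℕ} (ha : ((p : ℤ_[p]) ^ n) ∣ (K σ).toAdd - a) :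
    χ ((modNCyclotomicCharacter ℚ m σ : (ZMod m)ˣ) : ZMod m) =
      χ ((modNCyclotomicCharacter ℚ m γ : (ZMod m)ˣ) : ZMod m) ^ a := by
  have hτ := hχ _ (pow_inv_mul_mem_layerSubgroup hγ ha)
  have hσ : σ = γ ^ a * ((γ ^ a)⁻¹ * σ) := by group
  rw [hσ, map_mul, Units.val_mul, map_mul, hτ, mul_one, map_pow, Units.val_pow_eq_pow_val, map_pow]

/-- `χ̄(χ_cyc σ) = χ̄(χ_cyc γ)^a` (inverse character). [cite: Washington1997, §13.1] -/
theorem inv_apply_cyc_eq_pow (hγ : K.IsTopGenerator γ) {n : ℕ} (χ : DirichletCharacter ℂ m)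
    (hχ : ∀ τ ∈ K.layerSubgroup n, χ ((modNCyclotomicCharacter ℚ m τ : (ZMod m)ˣ) : ZMod m) = 1)
    {σ : absoluteGaloisGroup ℚ} {a : ℕ} (ha : ((p : ℤ_[p]) ^ n) ∣ (K σ).toAdd - a) :
    χ⁻¹ ((modNCyclotomicCharacter ℚ m σ : (ZMod m)ˣ) : ZMod m) =
      χ⁻¹ ((modNCyclotomicCharacter ℚ m γ : (ZMod m)ˣ) : ZMod m) ^ a := by
  rw [MulChar.inv_apply_eq_inv', MulChar.inv_apply_eq_inv', apply_cyc_eq_pow hγ χ hχ ha, inv_pow]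

/-- ★ **The dictionary**: `1 ⊗ χ̄(χ_cyc σ) = r(u − 1)` in `ℚ_p ⊗_ℚ ℂ`, `u = 1 ⊗ χ̄(χ_cyc γ)`, for every polynomial representative
`r ≡ (1 + T)^{κ(σ)} (mod ω_n)` — the value of `χ̄` at `σ` is the value at `u` of the group-like Iwasawa element `[σ]`.
[cite: Washington1997, §7.1 and §13.1] [cite: Kato2004Asterisque, §13.8 (p. 228)] -/
theorem one_tmul_inv_apply_cyc_eq_aeval (hγ : K.IsTopGenerator γ) (n : ℕ) (χ : DirichletCharacter ℂ m)
    (hχ : ∀ τ ∈ K.layerSubgroup n, χ ((modNCyclotomicCharacter ℚ m τ : (ZMod m)ˣ) : ZMod m) = 1)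
    (σ : absoluteGaloisGroup ℚ) {r : Polynomial ℤ_[p]}
    (hr : PowerSeries.binomialSeries ℤ_[p] (K σ).toAdd - (r : PowerSeries ℤ_[p]) ∈
      Ideal.span {(((Polynomial.X + 1 : Polynomial ℤ_[p]) ^ p ^ n - 1 : Polynomial ℤ_[p]) : PowerSeries ℤ_[p])}) :
    ((1 : ℚ_[p]) ⊗ₜ[ℚ] χ⁻¹ ((modNCyclotomicCharacter ℚ m σ : (ZMod m)ˣ) : ZMod m) : ℚ_[p] ⊗[ℚ] ℂ) =
      aeval (((1 : ℚ_[p]) ⊗ₜ[ℚ] χ⁻¹ ((modNCyclotomicCharacter ℚ m γ : (ZMod m)ˣ) : ZMod m) : ℚ_[p] ⊗[ℚ] ℂ) - 1) r := by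
  -- a residue `a ∈ ℕ` of `κ(σ)` mod `p^n`
  obtain ⟨a, ha⟩ : ∃ a : ℕ, ((p : ℤ_[p]) ^ n) ∣ (K σ).toAdd - a :=
    ⟨((K σ).toAdd).appr n, Ideal.mem_span_singleton.mp (PadicInt.appr_spec n _)⟩
  rw [aeval_eq_pow_of_binomialSeries (one_tmul_inv_apply_pow_eq_one hγ n χ hχ) ha hr, Algebra.TensorProduct.tmul_pow,
    one_pow, ← inv_apply_cyc_eq_pow hγ χ hχ ha]

end Summit.BirchSwinnertonDyer.Rank1Residual.Additive.PerrinRiouUnit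

end
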